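import Summits.AtomisticToContinuum.FouriersLaw.Theses.EmbeddedDrudeMourre
import Summits.AtomisticToContinuum.FouriersLaw.Theses.OddSectorIrreversibility
import Literature.MathematicalPhysics.KineticTheory.LangevinChainGibbs
import Literature.MathematicalPhysics.KineticTheory.LangevinSemigroupProofs
import Literature.MathematicalPhysics.KineticTheory.LangevinChainNESSProofs
import Literature.MathematicalPhysics.KineticTheory.LangevinChainLyapunovProofs

/-!
# `FiniteResponseOfUnique` (item stmt-AtomisticToContinuum-0717): reductions

`--supports` helper file for the shared support item `FiniteResponseOfUnique` (finite-`N` linear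
response of the steady current under weak-NESS uniqueness, route decl
`Summit.AtomisticToContinuum.FouriersLaw.Theses.EmbeddedDrudeMourre.FiniteResponseOfUnique`; the
same term is filed under ~45 routes of `FouriersLaw`).

What is proved here (sorry-free):

* §1 chains without bonds (`N ≤ 1`): every bond current vanishes identically, so the response
  quotient is `0` for every family and the limit exists with `D = 0`
  (`tendsto_response_of_le_one`).
* §2 equal bath temperatures under uniqueness: the steady state at `(T, T)` IS the Gibbs measure
  `Z⁻¹e^{-H/T}` (`steadyState_eq_gibbsMeasure_of_unique`), hence carries no current
  (`integral_bondCurrent_eq_zero_of_unique`, `totalCurrent_eq_zero_of_unique`) — the anchor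
  `J_N(T, T) = 0` without which the quotient `J/δ` along `𝓝[≠] 0` could not converge.
* §3 reduction to per-bond difference quotients at equilibrium
  (`tendsto_response_of_bond_quotients`): if each `(μ_δ(j_i) - μ_0(j_i))/δ` converges and
  `μ_0(j_i) = 0`, the response limit of the summed current exists (sum of the limits).
* §5 reduction to `N ≥ 2` (`finiteResponseOfUnique_of_two_le`).
* §6 **what uniqueness buys** (the analytic setting of the core, `N ≥ 1`, `T_L, T_R > 0`): every
  weak steady state has a smooth Lebesgue density (`hasSmoothDensity_of_isSteadyState`, proved
  Hörmander — no uniqueness needed), and under uniqueness at `(N, T_L, T_R)` the weak steady state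
  IS the invariant probability measure of the transition semigroup `pinnedChainSemigroup` of the
  Langevin SDE (CEHR 2018 Thm 2.13, proved in the tree): it is `P_t`-invariant, integrates
  `e^{ϑH}` for every `0 < ϑ < 1/max(T_L,T_R)`, and is the limit in the exponential convergence
  (2.5) (`isInvariant_of_isSteadyState_of_unique`, `integrable_exp_of_isSteadyState_of_unique`,
  `exp_convergence_of_isSteadyState_of_unique`).
* §4 **item 9144 ⇒ item 0717**: the response-density statement `ResponseDensity` of route
  `OddSectorIrreversibility` (stmt-AtomisticToContinuum-9144: an `L²` linear-response density `h`
  with `d/dδ μ_δ(j_i)|₀ = μ_0(j_i h)` for every bond) implies `FiniteResponseOfUnique` outright,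
  with `D_N(T) = Σ_i ∫ j_i h dμ_{N,T,T}` (`finiteResponseOfUnique_of_responseDensity`). Both items
  carry the same analytic content (Hairer–Majda linear response for the hypoelliptic Langevin
  chain, Rey-Bellet 2003 Rem. 4.4); 0717 is the bond-summed corollary.

Not here: the analytic core itself (differentiability at `δ = 0` of `δ ↦ μ_{N,T+δ/2,T-δ/2}(j_i)`
for `N ≥ 2`), which is not in print as a theorem for Langevin baths (grounding of 0717/9144).
-/

noncomputable section

namespace Summit.AtomisticToContinuum.FouriersLaw.Theorems.FiniteResponse

open MeasureTheory Filter Topology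
open Literature.MathematicalPhysics.KineticTheory.HeatConduction

/-! ## §1 Chains without bonds -/

/-- For `N ≤ 1` there is no bond `(i, i+1)`, so every bond current is identically `0`.
[folklore] -/
theorem bondCurrent_eq_zero_of_le_one (P : OscillatorChain) {N : ℕ} (hN : N ≤ 1) (i : Fin N)
    (x : PhaseSpace N) : P.bondCurrent N i x = 0 := by
  unfold OscillatorChain.bondCurrent
  refine Finset.sum_eq_zero fun j _ => ?_
  have hj : ¬ (j.val = i.val + 1) := by
    have := j.isLt
    omega
  simp [hj]

/-- For `N ≤ 1` the space-summed current of ANY measure vanishes. [folklore] -/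
theorem totalCurrent_eq_zero_of_le_one (P : OscillatorChain) {N : ℕ} (hN : N ≤ 1)
    (μ : Measure (PhaseSpace N)) : P.totalCurrent μ = 0 := by
  unfold OscillatorChain.totalCurrent
  refine Finset.sum_eq_zero fun i _ => ?_
  simp [bondCurrent_eq_zero_of_le_one P hN]

/-- **The item for `N ≤ 1`, unconditionally**: the response quotient is identically `0`, so the
finite-`N` linear response exists with `D = 0` for every family of measures. [folklore] -/
theorem tendsto_response_of_le_one (P : OscillatorChain) {N : ℕ} (hN : N ≤ 1)
    (μ : ℝ → ℝ → Measure (PhaseSpace N)) (T : ℝ) :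
    Tendsto (fun δ : ℝ => P.totalCurrent (μ (T + δ / 2) (T - δ / 2)) / δ) (𝓝[≠] 0) (𝓝 0) := by
  simp only [totalCurrent_eq_zero_of_le_one P hN, zero_div]
  exact tendsto_const_nhds

/-! ## §2 Equal temperatures under uniqueness: the steady state is the Gibbs state -/

section Pinned

variable {ω₂ lam β γ : ℝ}

/-- **Under weak-NESS uniqueness at `(N, T, T)` the steady state is the Gibbs measure**
`Z⁻¹ e^{-H/T} dq dp` (which is a weak steady state, `pinnedChain_isSteadyState_gibbsMeasure`).
[folklore] -/
theorem steadyState_eq_gibbsMeasure_of_unique (hω : 0 < ω₂) (hl : 0 ≤ lam) (hβ : 0 ≤ β)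
    {N : ℕ} {T : ℝ} (hT : 0 < T)
    (huniq : ∀ μ ν : Measure (PhaseSpace N),
      (pinnedChain ω₂ lam β γ).IsSteadyState N T T μ →
        (pinnedChain ω₂ lam β γ).IsSteadyState N T T ν → μ = ν)
    {μ₀ : Measure (PhaseSpace N)} (hμ₀ : (pinnedChain ω₂ lam β γ).IsSteadyState N T T μ₀) :
    μ₀ = (pinnedChain ω₂ lam β γ).gibbsMeasure N T :=
  huniq _ _ hμ₀ (pinnedChain_isSteadyState_gibbsMeasure hω hl hβ γ N hT)

/-- Under uniqueness at `(N, T, T)`, every bond current has mean `0` in the steady state at equal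
temperatures (no current at equilibrium, `pinnedChain_integral_bondCurrent_gibbsMeasure`).
[folklore] -/
theorem integral_bondCurrent_eq_zero_of_unique (hω : 0 < ω₂) (hl : 0 ≤ lam) (hβ : 0 ≤ β)
    {N : ℕ} {T : ℝ} (hT : 0 < T)
    (huniq : ∀ μ ν : Measure (PhaseSpace N),
      (pinnedChain ω₂ lam β γ).IsSteadyState N T T μ →
        (pinnedChain ω₂ lam β γ).IsSteadyState N T T ν → μ = ν)
    {μ₀ : Measure (PhaseSpace N)} (hμ₀ : (pinnedChain ω₂ lam β γ).IsSteadyState N T T μ₀)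
    (i : Fin N) :
    ∫ x, (pinnedChain ω₂ lam β γ).bondCurrent N i x ∂μ₀ = 0 := by
  rw [steadyState_eq_gibbsMeasure_of_unique hω hl hβ hT huniq hμ₀]
  exact pinnedChain_integral_bondCurrent_gibbsMeasure ω₂ lam β γ N T i

/-- Under uniqueness at `(N, T, T)`, the steady state at equal temperatures carries no total
current: `J_N(T, T) = 0`. [folklore] -/
theorem totalCurrent_eq_zero_of_unique (hω : 0 < ω₂) (hl : 0 ≤ lam) (hβ : 0 ≤ β)
    {N : ℕ} {T : ℝ} (hT : 0 < T)
    (huniq : ∀ μ ν : Measure (PhaseSpace N),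
      (pinnedChain ω₂ lam β γ).IsSteadyState N T T μ →
        (pinnedChain ω₂ lam β γ).IsSteadyState N T T ν → μ = ν)
    {μ₀ : Measure (PhaseSpace N)} (hμ₀ : (pinnedChain ω₂ lam β γ).IsSteadyState N T T μ₀) :
    (pinnedChain ω₂ lam β γ).totalCurrent μ₀ = 0 := by
  rw [steadyState_eq_gibbsMeasure_of_unique hω hl hβ hT huniq hμ₀]
  exact pinnedChain_totalCurrent_gibbsMeasure ω₂ lam β γ N T

end Pinned

/-! ## §3 Reduction to per-bond difference quotients -/

/-- **Reduction to per-bond linear response.** If every bond current has mean `0` in `μ T T` and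
each per-bond difference quotient `(μ_{T+δ/2,T-δ/2}(j_i) - μ_{T,T}(j_i))/δ` converges along
`δ → 0, δ ≠ 0`, then the response quotient of the summed current converges to the sum of the
limits. [folklore] -/
theorem tendsto_response_of_bond_quotients (P : OscillatorChain) {N : ℕ}
    (μ : ℝ → ℝ → Measure (PhaseSpace N)) (T : ℝ) (c : Fin N → ℝ)
    (h0 : ∀ i : Fin N, ∫ x, P.bondCurrent N i x ∂(μ T T) = 0)
    (h : ∀ i : Fin N, Tendsto
      (fun δ : ℝ => ((∫ x, P.bondCurrent N i x ∂(μ (T + δ / 2) (T - δ / 2))) -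
        ∫ x, P.bondCurrent N i x ∂(μ T T)) / δ) (𝓝[≠] 0) (𝓝 (c i))) :
    Tendsto (fun δ : ℝ => P.totalCurrent (μ (T + δ / 2) (T - δ / 2)) / δ) (𝓝[≠] 0)
      (𝓝 (∑ i, c i)) := by
  have hfun : (fun δ : ℝ => P.totalCurrent (μ (T + δ / 2) (T - δ / 2)) / δ) =
      fun δ : ℝ => ∑ i : Fin N, ((∫ x, P.bondCurrent N i x ∂(μ (T + δ / 2) (T - δ / 2))) -
        ∫ x, P.bondCurrent N i x ∂(μ T T)) / δ := by
    funext δ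
    simp only [OscillatorChain.totalCurrent, h0, sub_zero, Finset.sum_div]
  rw [hfun]
  exact tendsto_finsetSum _ fun i _ => h i

/-! ## §4 Item 9144 (`ResponseDensity`) implies item 0717 (`FiniteResponseOfUnique`) -/

/-- **`ResponseDensity → FiniteResponseOfUnique`** (stmt-9144 ⇒ stmt-0717). Given the `L²`
linear-response density `h` of the steady state at `(N, T, T)` with
`lim_{δ→0,δ≠0} (μ_δ(j_i) - μ_0(j_i))/δ = ∫ j_i h dμ_0` for every bond, the finite-`N` response of
the summed current exists and equals `D_N(T) = Σ_i ∫ j_i h dμ_{N,T,T}`: at `(T, T)` the steady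
state is the Gibbs measure by uniqueness, which carries no current, so the response quotient is the
sum of the per-bond difference quotients. [folklore] -/
theorem finiteResponseOfUnique_of_responseDensity
    (hRD : Summit.AtomisticToContinuum.FouriersLaw.Theses.OddSectorIrreversibility.ResponseDensity) :
    Summit.AtomisticToContinuum.FouriersLaw.Theses.EmbeddedDrudeMourre.FiniteResponseOfUnique := by
  intro ω₂ lam β γ hω hl hβ hγ huniq μ hμ T hT N
  obtain ⟨h, -, -, hbond⟩ := hRD ω₂ lam β γ hω hl hβ hγ huniq μ hμ T hT N
  refine ⟨∑ i : Fin N, ∫ x, (pinnedChain ω₂ lam β γ).bondCurrent N i x * h x ∂(μ N T T), ?_⟩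
  refine tendsto_response_of_bond_quotients (pinnedChain ω₂ lam β γ) (μ N) T _ (fun i => ?_) hbond
  exact integral_bondCurrent_eq_zero_of_unique hω hl.le hβ.le hT (huniq N T T hT hT) (hμ N T T hT hT) i

/-- The same implication with the response-density hypothesis needed ONLY at the given parameters,
temperature and length, and only its bond-current clause: a per-`(T, N)` form for later use (e.g.
by a proof of the analytic core one `N` at a time). [folklore] -/
theorem exists_tendsto_response_of_bond_response {ω₂ lam β γ : ℝ} (hω : 0 < ω₂) (hl : 0 ≤ lam)
    (hβ : 0 ≤ β) {N : ℕ} {T : ℝ} (hT : 0 < T)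
    (huniq : ∀ μ ν : Measure (PhaseSpace N),
      (pinnedChain ω₂ lam β γ).IsSteadyState N T T μ →
        (pinnedChain ω₂ lam β γ).IsSteadyState N T T ν → μ = ν)
    (μ : ℝ → ℝ → Measure (PhaseSpace N)) (hμ : (pinnedChain ω₂ lam β γ).IsSteadyState N T T (μ T T))
    (c : Fin N → ℝ)
    (hbond : ∀ i : Fin N, Tendsto
      (fun δ : ℝ => ((∫ x, (pinnedChain ω₂ lam β γ).bondCurrent N i x ∂(μ (T + δ / 2) (T - δ / 2))) -
        ∫ x, (pinnedChain ω₂ lam β γ).bondCurrent N i x ∂(μ T T)) / δ) (𝓝[≠] 0) (𝓝 (c i))) :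
    ∃ D : ℝ, Tendsto (fun δ : ℝ =>
      (pinnedChain ω₂ lam β γ).totalCurrent (μ (T + δ / 2) (T - δ / 2)) / δ) (𝓝[≠] 0) (𝓝 D) :=
  ⟨∑ i, c i, tendsto_response_of_bond_quotients (pinnedChain ω₂ lam β γ) μ T c
    (fun i => integral_bondCurrent_eq_zero_of_unique hω hl hβ hT huniq hμ i) hbond⟩

/-! ## §5 It suffices to treat chains with at least one bond -/

/-- **Reduction to `N ≥ 2`.** `FiniteResponseOfUnique` follows from its restriction to chains with
at least two sites (for `N ≤ 1` the response quotient is identically `0`,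
`tendsto_response_of_le_one`). [folklore] -/
theorem finiteResponseOfUnique_of_two_le
    (h2 : ∀ ω₂ lam β γ : ℝ, 0 < ω₂ → 0 < lam → 0 < β → 0 < γ →
      (∀ (N : ℕ) (T_L T_R : ℝ), 0 < T_L → 0 < T_R → ∀ μ ν : Measure (PhaseSpace N),
        (pinnedChain ω₂ lam β γ).IsSteadyState N T_L T_R μ →
          (pinnedChain ω₂ lam β γ).IsSteadyState N T_L T_R ν → μ = ν) →
      ∀ μ : (N : ℕ) → ℝ → ℝ → Measure (PhaseSpace N),
        (∀ (N : ℕ) (T_L T_R : ℝ), 0 < T_L → 0 < T_R →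
          (pinnedChain ω₂ lam β γ).IsSteadyState N T_L T_R (μ N T_L T_R)) →
        ∀ T : ℝ, 0 < T → ∀ N : ℕ, 2 ≤ N → ∃ D : ℝ,
          Tendsto (fun δ : ℝ =>
            (pinnedChain ω₂ lam β γ).totalCurrent (μ N (T + δ / 2) (T - δ / 2)) / δ)
            (𝓝[≠] 0) (𝓝 D)) :
    Summit.AtomisticToContinuum.FouriersLaw.Theses.EmbeddedDrudeMourre.FiniteResponseOfUnique := by
  intro ω₂ lam β γ hω hl hβ hγ huniq μ hμ T hT N
  rcases Nat.lt_or_ge N 2 with hN | hN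
  · exact ⟨0, tendsto_response_of_le_one _ (by omega) (μ N) T⟩
  · exact h2 ω₂ lam β γ hω hl hβ hγ huniq μ hμ T hT N hN

/-! ## §6 What uniqueness buys: the steady state is the CEHR invariant measure -/

section Identification

variable {ω₂ lam β γ : ℝ}

/-- **Every weak steady state of the pinned chain has a smooth density** (`ω₂, β, γ > 0`,
`lam ≥ 0`, `N ≥ 1`, `T_L, T_R > 0`; no uniqueness needed): the weak Fokker–Planck equation
`∫ L f dμ = 0` on `C_c^∞` and hypoellipticity of `L*` (CEHR 2018 Prop. 3.2/4.1 with Hörmander's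
Thm 1.1, all proved in the tree: `CuneoEckmannHairerReyBellet2018_smoothDensity_holds`).
[folklore] -/
theorem hasSmoothDensity_of_isSteadyState (hω : 0 < ω₂) (hl : 0 ≤ lam) (hβ : 0 < β) (hγ : 0 < γ)
    {N : ℕ} (hN : 0 < N) {T_L T_R : ℝ} (hL : 0 < T_L) (hR : 0 < T_R)
    {μ : Measure (PhaseSpace N)} (hμ : (pinnedChain ω₂ lam β γ).IsSteadyState N T_L T_R μ) :
    HasSmoothDensity μ := by
  haveI := hμ.1
  exact CuneoEckmannHairerReyBellet2018_smoothDensity_holds ω₂ lam β γ hω hl hβ hγ N T_L T_R hN hL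
    hR μ inferInstance hμ.2.1

/-- **Under uniqueness the weak steady state is `P_t`-invariant** for the transition semigroup
`pinnedChainSemigroup` of the Langevin SDE: the semigroup's invariant probability measure `μ⋆`
(CEHR Thm 2.13 (2), `pinnedChainSemigroup_ergodic`) is itself a weak steady state
(`pinnedChain_isSteadyState_of_isInvariant`), hence equals `μ`. [folklore] -/
theorem isInvariant_of_isSteadyState_of_unique (hω : 0 < ω₂) (hl : 0 ≤ lam) (hβ : 0 < β)
    (hγ : 0 < γ) {N : ℕ} (hN : 0 < N) {T_L T_R : ℝ} (hL : 0 < T_L) (hR : 0 < T_R)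
    (huniq : ∀ μ ν : Measure (PhaseSpace N),
      (pinnedChain ω₂ lam β γ).IsSteadyState N T_L T_R μ →
        (pinnedChain ω₂ lam β γ).IsSteadyState N T_L T_R ν → μ = ν)
    {μ : Measure (PhaseSpace N)} (hμ : (pinnedChain ω₂ lam β γ).IsSteadyState N T_L T_R μ) :
    (pinnedChainSemigroup hω hl hβ.le hγ.le hN hL.le hR.le).IsInvariant μ := by
  obtain ⟨-, μs, hμs, hinv, hrest⟩ := pinnedChainSemigroup_ergodic hω hl hβ hγ hN hL hR
  have hmax : 0 < 1 / max T_L T_R := by positivity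
  have hss : (pinnedChain ω₂ lam β γ).IsSteadyState N T_L T_R μs :=
    pinnedChain_isSteadyState_of_isInvariant hω.le hl hβ.le γ N _ hinv (half_pos hmax)
      (hrest _ (half_pos hmax) (half_lt_self hmax)).1
  rw [huniq μ μs hμ hss]
  exact hinv

/-- **Under uniqueness the weak steady state integrates `e^{ϑH}`** for every
`0 < ϑ < 1/max(T_L, T_R)` (CEHR Thm 2.13 (2) for the semigroup's invariant measure, transferred
by uniqueness). [folklore] -/
theorem integrable_exp_of_isSteadyState_of_unique (hω : 0 < ω₂) (hl : 0 ≤ lam) (hβ : 0 < β)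
    (hγ : 0 < γ) {N : ℕ} (hN : 0 < N) {T_L T_R : ℝ} (hL : 0 < T_L) (hR : 0 < T_R)
    (huniq : ∀ μ ν : Measure (PhaseSpace N),
      (pinnedChain ω₂ lam β γ).IsSteadyState N T_L T_R μ →
        (pinnedChain ω₂ lam β γ).IsSteadyState N T_L T_R ν → μ = ν)
    {μ : Measure (PhaseSpace N)} (hμ : (pinnedChain ω₂ lam β γ).IsSteadyState N T_L T_R μ)
    {ϑ : ℝ} (hϑ : 0 < ϑ) (hϑ' : ϑ < 1 / max T_L T_R) :
    Integrable (fun z => Real.exp (ϑ * (pinnedChain ω₂ lam β γ).hamiltonian N z)) μ := by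
  obtain ⟨-, μs, hμs, hinv, hrest⟩ := pinnedChainSemigroup_ergodic hω hl hβ hγ hN hL hR
  have hmax : 0 < 1 / max T_L T_R := by positivity
  have hss : (pinnedChain ω₂ lam β γ).IsSteadyState N T_L T_R μs :=
    pinnedChain_isSteadyState_of_isInvariant hω.le hl hβ.le γ N _ hinv (half_pos hmax)
      (hrest _ (half_pos hmax) (half_lt_self hmax)).1
  rw [huniq μ μs hμ hss]
  exact (hrest ϑ hϑ hϑ').1

/-- **Under uniqueness the weak steady state is the limit in the exponential convergence (2.5)**:
for every `0 < ϑ < 1/max(T_L,T_R)` there are `C, c > 0` with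
`|P_t f(z) - ∫ f dμ| ≤ C e^{ϑH(z)} e^{-ct}` for all `z`, `t ≥ 0` and continuous `|f| ≤ e^{ϑH}`
(CEHR Thm 2.13 (3), proved in the tree for `pinnedChainSemigroup`, transferred by uniqueness).
[folklore] -/
theorem exp_convergence_of_isSteadyState_of_unique (hω : 0 < ω₂) (hl : 0 ≤ lam) (hβ : 0 < β)
    (hγ : 0 < γ) {N : ℕ} (hN : 0 < N) {T_L T_R : ℝ} (hL : 0 < T_L) (hR : 0 < T_R)
    (huniq : ∀ μ ν : Measure (PhaseSpace N),
      (pinnedChain ω₂ lam β γ).IsSteadyState N T_L T_R μ →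
        (pinnedChain ω₂ lam β γ).IsSteadyState N T_L T_R ν → μ = ν)
    {μ : Measure (PhaseSpace N)} (hμ : (pinnedChain ω₂ lam β γ).IsSteadyState N T_L T_R μ)
    {ϑ : ℝ} (hϑ : 0 < ϑ) (hϑ' : ϑ < 1 / max T_L T_R) :
    ∃ C c : ℝ, 0 < C ∧ 0 < c ∧
      ∀ (z : PhaseSpace N) (t : NNReal) (f : PhaseSpace N → ℝ), Continuous f →
        (∀ y, |f y| ≤ Real.exp (ϑ * (pinnedChain ω₂ lam β γ).hamiltonian N y)) →
        |(pinnedChainSemigroup hω hl hβ.le hγ.le hN hL.le hR.le).act t f z - ∫ y, f y ∂μ| ≤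
          C * Real.exp (ϑ * (pinnedChain ω₂ lam β γ).hamiltonian N z) * Real.exp (-c * t) := by
  obtain ⟨-, μs, hμs, hinv, hrest⟩ := pinnedChainSemigroup_ergodic hω hl hβ hγ hN hL hR
  have hmax : 0 < 1 / max T_L T_R := by positivity
  have hss : (pinnedChain ω₂ lam β γ).IsSteadyState N T_L T_R μs :=
    pinnedChain_isSteadyState_of_isInvariant hω.le hl hβ.le γ N _ hinv (half_pos hmax)
      (hrest _ (half_pos hmax) (half_lt_self hmax)).1
  rw [huniq μ μs hμ hss]
  exact (hrest ϑ hϑ hϑ').2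

/-- **Integrability of exponentially dominated observables in the steady state** (under
uniqueness): a continuous... in fact any a.e.-strongly measurable `g` with `|g| ≤ K e^{ϑH}`,
`0 < ϑ < 1/max(T_L,T_R)`, is `μ`-integrable — in particular every polynomial observable (bond
currents, `p_b²`, `p_b ∂_{p_b}F` for exponentially dominated `F`, …). [folklore] -/
theorem integrable_of_abs_le_exp_of_unique (hω : 0 < ω₂) (hl : 0 ≤ lam) (hβ : 0 < β)
    (hγ : 0 < γ) {N : ℕ} (hN : 0 < N) {T_L T_R : ℝ} (hL : 0 < T_L) (hR : 0 < T_R)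
    (huniq : ∀ μ ν : Measure (PhaseSpace N),
      (pinnedChain ω₂ lam β γ).IsSteadyState N T_L T_R μ →
        (pinnedChain ω₂ lam β γ).IsSteadyState N T_L T_R ν → μ = ν)
    {μ : Measure (PhaseSpace N)} (hμ : (pinnedChain ω₂ lam β γ).IsSteadyState N T_L T_R μ)
    {ϑ : ℝ} (hϑ : 0 < ϑ) (hϑ' : ϑ < 1 / max T_L T_R) {g : PhaseSpace N → ℝ}
    (hg : AEStronglyMeasurable g μ) {K : ℝ}
    (hgK : ∀ z, |g z| ≤ K * Real.exp (ϑ * (pinnedChain ω₂ lam β γ).hamiltonian N z)) :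
    Integrable g μ := by
  refine ((integrable_exp_of_isSteadyState_of_unique hω hl hβ hγ hN hL hR huniq hμ hϑ
    hϑ').const_mul K).mono' hg (Filter.Eventually.of_forall fun z => ?_)
  rw [Real.norm_eq_abs]
  exact hgK z

end Identification

end Summit.AtomisticToContinuum.FouriersLaw.Theorems.FiniteResponse

end
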